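import Mathlib
import Summits.NavierStokesRegularity.NavierStokesRegularity.Theorems.WakeRatchetTailRatchetPeakDelayChain
import Summits.NavierStokesRegularity.NavierStokesRegularity.Theorems.WakeRatchetTailRatchetPeakDelayMutual
import HarnessLib

/-!
# `WakeRatchet.TailRatchet` (stmt-NavierStokesRegularity-21808), door D4′ — the FIRED-CHAIN reduction:
# (U) + (O) + (L) level maintenance from first firing to peak + (B) bounded fired-and-rising chain ⟹ (R′) ⟹ (D) ⟹ ¬TailRatchet,
# with the look-ahead input (S) replaced by leading-edge bounds of the two shells above

Def-free bookkeeping (`--supports stmt-NavierStokesRegularity-21808`), refining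
`WakeRatchetPeakDelaySelfDrain.cauchyPostFiringBound_of_risingChain` (p840491).  Each step `[a, pₖ]` of the chain
iteration is split at the first firing `sₖ₊₁` of the shell above: before it, the leading-edge bounds
`Λᵏ⁺¹Xₖ₊₁(T−τ) ≤ c₁`, `Λᵏ⁺²Xₖ₊₂(T−τ) ≤ c₂` (`c₁c₂ ≤ Λ²c²/2`; the tree's unconditional clock gives `c₁ = c₀`, `c₂ = Λc₀²`
on `[sₖ, sₖ₊₁)`, p839816) yield (S) (`lookahead_of_leadingEdge`) and the self-drain step (`dyadic_peak_delay_bottom_shell`,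
factor `C₁ = 2 + 4ΛK²/c³`); after it, shells `k` and `k+1` both hold the level `c` and the coexistence step
(`dyadic_coexist_bottom_shell`, factor `C₂ = 1 + Λ²K²/c²`) applies.  Hence (`chain_iterate_fired`,
`peakDelay_of_firedChain`): (U) + (O) + (L) [`ΛᵏXₖ(τ)(T−τ) ≥ c` on `[sₖ, pₖ]`] + (E) [edge bounds on `[sₖ, sₖ₊₁]`] +
(B) [when shell `n` is at level `≥ c₀` at `t < pₙ`, the shells `k ∈ [n−j₀, n]`, `j₀ < J`, are fired and not peaked,
`sₖ ≤ t ≤ pₖ`, and `p_{n−j₀−1} ≤ t`] ⟹ (R′) with `K = (C₁C₂)^J`; then (D) and ¬TailRatchet by the tree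
(`cauchyPostFiringBound_of_firedChain`, `TailRatchet_false_of_firedChain`).

HONEST FRAMING: MODEL lattice ODEs (Tao 2016 §1.2, §4); bookkeeping only — (U), (O), (L), (E) at the firing instants, (B)
are hypotheses, NOT proved; (D) is not proved; stmt-21808 is neither proved nor refuted; no stub of skeleton d00b85951d7c
is closed; rung 0.
-/

noncomputable section

set_option linter.dupNamespace false

namespace Summit.NavierStokesRegularity.NavierStokesRegularity.Theorems

namespace WakeRatchetPeakDelaySelfDrain

open Set
open Literature.Analysis.FluidPDE Literature.Analysis.FluidPDE.TaoCascade
open WakeRatchetDyadicPostFiring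

/-- **Fired-chain iteration (one bundle).**  As `chain_iterate`, with the look-ahead hypothesis replaced by: first-firing
times `s` with EDGE bounds `Λᵏ⁺¹Xₖ₊₁(τ)(T−τ) ≤ c₁`, `Λᵏ⁺²Xₖ₊₂(τ)(T−τ) ≤ c₂` on `[sₖ, sₖ₊₁]` (`c₁c₂ ≤ Λ²c²/2`) and LEVEL
maintenance `ΛᵏXₖ(τ)(T−τ) ≥ c` on `[sₖ, pₖ]`, for a chain of fired, not yet peaked shells `k ∈ [n−j₀, n]`
(`sₖ ≤ t ≤ pₖ`) above a peaked one (`p_{n−j₀−1} ≤ t`): `T* − t ≤ (C₁C₂)^{j₀+1}(T* − pₙ)`.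
[cite: Tao2016AveragedNS, §1.2 (dyadic model), §4 Lemma 4.1 (4.8); elementary (door D4′ of stmt-21808)] -/
theorem chain_iterate_fired {X : ℤ → ℝ → ℝ} {Λ KI c c₁ c₂ Tstar δ t : ℝ} {p s : ℤ → ℝ} {n : ℤ} {j₀ : ℕ}
    (hΛ : 0 < Λ) (hc : 0 < c) (hδ : 0 < δ) (hcc : c₁ * c₂ ≤ Λ ^ 2 * c ^ 2 / 2)
    (hlaw : ∀ m : ℤ, ∀ τ ∈ Ioo (-δ) Tstar,
      HasDerivAt (X m) (Λ ^ (m - 1) * X (m - 1) τ ^ 2 - Λ ^ m * X m τ * X (m + 1) τ) τ)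
    (hnn : ∀ m : ℤ, ∀ τ ∈ Ico 0 Tstar, 0 ≤ X m τ)
    (htypeI : ∀ m : ℤ, ∀ τ ∈ Ico 0 Tstar, Λ ^ m * X m τ * (Tstar - τ) ≤ KI)
    (hU : ∀ m : ℤ, p m ∈ Ico 0 Tstar ∧ MonotoneOn (X m) (Icc 0 (p m)) ∧ AntitoneOn (X m) (Ico (p m) Tstar))
    (hO : ∀ m : ℤ, p m ≤ p (m + 1))
    (hE : ∀ k : ℤ, ∀ τ ∈ Icc (s k) (s (k + 1)), τ ∈ Ico 0 Tstar →
      Λ ^ (k + 1) * X (k + 1) τ * (Tstar - τ) ≤ c₁ ∧ Λ ^ (k + 2) * X (k + 2) τ * (Tstar - τ) ≤ c₂)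
    (hL : ∀ k : ℤ, ∀ τ ∈ Icc (s k) (p k), τ ∈ Ico 0 Tstar → c ≤ Λ ^ k * X k τ * (Tstar - τ))
    (ht : t ∈ Ico 0 Tstar) (hbot : p (n - j₀ - 1) ≤ t)
    (hch : ∀ k : ℤ, n - j₀ ≤ k → k ≤ n → s k ≤ t ∧ t ≤ p k) :
    Tstar - t ≤ ((2 + 4 * Λ * KI ^ 2 / c ^ 3) * (1 + Λ ^ 2 * KI ^ 2 / (c * c))) ^ (j₀ + 1) * (Tstar - p n) := by
  set C₁ : ℝ := 2 + 4 * Λ * KI ^ 2 / c ^ 3 with hC₁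
  set C₂ : ℝ := 1 + Λ ^ 2 * KI ^ 2 / (c * c) with hC₂
  have hC₁1 : 1 ≤ C₁ := by
    have : 0 ≤ 4 * Λ * KI ^ 2 / c ^ 3 := by positivity
    linarith
  have hC₂1 : 1 ≤ C₂ := by
    have : 0 ≤ Λ ^ 2 * KI ^ 2 / (c * c) := by positivity
    linarith
  have hC₁0 : 0 ≤ C₁ := by linarith
  have hC₂0 : 0 ≤ C₂ := by linarith
  set C : ℝ := C₁ * C₂ with hC
  have hC0 : 0 ≤ C := mul_nonneg hC₁0 hC₂0
  -- one step on [a, p k]: shell k fired (s k ≤ a), shell k-1 peaked (p (k-1) ≤ a), t ≤ a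
  have step : ∀ (k : ℤ) (a : ℝ), n - j₀ ≤ k → k ≤ n → a ∈ Ico 0 Tstar → s k ≤ a → a ≤ p k →
      p (k - 1) ≤ a → Tstar - a ≤ C * (Tstar - p k) := by
    intro k a hk1 hk2 ha hsa hap hpk
    obtain ⟨hpkI, hmono, hanti⟩ := hU k
    obtain ⟨-, -, hantim⟩ := hU (k - 1)
    obtain ⟨hpk1I, -, -⟩ := hU (k + 1)
    have hTpk : 0 < Tstar - p k := by linarith [hpkI.2]
    have hsubI : ∀ τ ∈ Icc a (p k), τ ∈ Ioo (-δ) Tstar := fun τ hτ =>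
      ⟨by linarith [ha.1, hτ.1], lt_of_le_of_lt hτ.2 hpkI.2⟩
    have hsub0 : ∀ τ ∈ Icc a (p k), τ ∈ Ico 0 Tstar := fun τ hτ =>
      ⟨ha.1.trans hτ.1, lt_of_le_of_lt hτ.2 hpkI.2⟩
    -- phase 1 on [a, b] with b ≤ s (k+1), b ≤ p k: self-drain with (S) from the edge bounds
    have phase1 : ∀ b : ℝ, a ≤ b → b ≤ p k → b ≤ s (k + 1) → Tstar - a ≤ C₁ * (Tstar - b) := by
      intro b hab hbp hbs
      have hbT : b < Tstar := lt_of_le_of_lt hbp hpkI.2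
      have hIab : ∀ τ ∈ Icc a b, τ ∈ Icc a (p k) := fun τ hτ => ⟨hτ.1, hτ.2.trans hbp⟩
      refine dyadic_peak_delay_bottom_shell (X := X) (k := k) hΛ hc hab hbT ?_ ?_ ?_ ?_ (htypeI (k - 1) a ha)
        ?_ ?_ ?_
      · intro τ hτ; exact hlaw k τ (hsubI τ (hIab τ hτ))
      · intro τ hτ
        have h := hlaw (k + 1) τ (hsubI τ (hIab τ hτ))
        have e1 : k + 1 - 1 = k := by ring
        have e2 : k + 1 + 1 = k + 2 := by ring
        rw [e1, e2] at h
        exact h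
      · intro j τ hτ; exact hnn j τ (hsub0 τ (hIab τ hτ))
      · intro τ hτ
        exact hantim ⟨hpk, ha.2⟩ ⟨hpk.trans hτ.1, (hsub0 τ (hIab τ hτ)).2⟩ hτ.1
      · intro τ hτ
        have hτ0 : τ ∈ Ico 0 Tstar := hsub0 τ (hIab τ hτ)
        have hτs : τ ∈ Icc (s k) (s (k + 1)) := ⟨hsa.trans hτ.1, hτ.2.trans hbs⟩
        obtain ⟨he1, he2⟩ := hE k τ hτs hτ0
        have hlk : c ≤ Λ ^ k * X k τ * (Tstar - τ) := hL k τ ⟨hsa.trans hτ.1, hτ.2.trans hbp⟩ hτ0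
        exact lookahead_of_leadingEdge hΛ hc.le hτ0.2 hcc (hnn _ τ hτ0) (hnn _ τ hτ0) hlk he1 he2
      · intro τ hτ
        exact hL k τ ⟨hsa.trans hτ.1, hτ.2.trans hbp⟩ (hsub0 τ (hIab τ hτ))
      · exact hmono ⟨ha.1, hap⟩ ⟨ha.1.trans hab, hbp⟩ hab
    -- phase 2 on [b', p k] with s (k+1) ≤ b', a ≤ b': coexistence of the levels of shells k and k+1
    have phase2 : ∀ b' : ℝ, a ≤ b' → b' ≤ p k → s (k + 1) ≤ b' → Tstar - b' ≤ C₂ * (Tstar - p k) := by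
      intro b' hab' hbp' hsb'
      have hb0 : b' ∈ Ico 0 Tstar := ⟨ha.1.trans hab', lt_of_le_of_lt hbp' hpkI.2⟩
      have hIb : ∀ τ ∈ Icc b' (p k), τ ∈ Icc a (p k) := fun τ hτ => ⟨hab'.trans hτ.1, hτ.2⟩
      refine dyadic_coexist_bottom_shell (X := X) (k := k) hΛ hc hc hbp' hpkI.2 ?_ ?_ ?_ (htypeI (k - 1) b' hb0)
        ?_ ?_ ?_
      · intro τ hτ; exact hlaw k τ (hsubI τ (hIb τ hτ))
      · intro j τ hτ; exact hnn j τ (hsub0 τ (hIb τ hτ))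
      · intro τ hτ
        exact hantim ⟨hpk.trans hab', hb0.2⟩ ⟨(hpk.trans hab').trans hτ.1, (hsub0 τ (hIb τ hτ)).2⟩ hτ.1
      · intro τ hτ
        exact hL k τ ⟨hsa.trans (hab'.trans hτ.1), hτ.2⟩ (hsub0 τ (hIb τ hτ))
      · intro τ hτ
        exact hL (k + 1) τ ⟨hsb'.trans hτ.1, hτ.2.trans (hO k)⟩ (hsub0 τ (hIb τ hτ))
      · exact hmono ⟨ha.1.trans hab', hbp'⟩ ⟨hpkI.1, le_rfl⟩ hbp'
    -- case split at the first firing of shell k+1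
    rcases le_or_gt (s (k + 1)) a with hs1 | hs1
    · -- shell k+1 already fired: coexistence on the whole window
      have h2 := phase2 a le_rfl hap hs1
      calc Tstar - a ≤ C₂ * (Tstar - p k) := h2
        _ ≤ C * (Tstar - p k) := by
            apply mul_le_mul_of_nonneg_right _ hTpk.le
            exact le_mul_of_one_le_left hC₂0 hC₁1
    · rcases le_or_gt (p k) (s (k + 1)) with hs2 | hs2
      · -- shell k+1 fires only after the peak of shell k: self-drain on the whole window
        have h1 := phase1 (p k) hap le_rfl hs2
        calc Tstar - a ≤ C₁ * (Tstar - p k) := h1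
          _ ≤ C * (Tstar - p k) := by
              apply mul_le_mul_of_nonneg_right _ hTpk.le
              exact le_mul_of_one_le_right hC₁0 hC₂1
      · -- split at s (k+1)
        have h1 := phase1 (s (k + 1)) hs1.le hs2.le le_rfl
        have h2 := phase2 (s (k + 1)) hs1.le hs2.le le_rfl
        calc Tstar - a ≤ C₁ * (Tstar - s (k + 1)) := h1
          _ ≤ C₁ * (C₂ * (Tstar - p k)) := mul_le_mul_of_nonneg_left h2 hC₁0
          _ = C * (Tstar - p k) := by rw [hC]; ring
  -- induction up the chain (as in `chain_iterate`)
  have main : ∀ j : ℕ, j ≤ j₀ → Tstar - t ≤ C ^ (j + 1) * (Tstar - p (n - j₀ + j)) := by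
    intro j
    induction j with
    | zero =>
      intro _
      have hk : n - (j₀ : ℤ) + ((0 : ℕ) : ℤ) = n - j₀ := by push_cast; ring
      rw [hk, zero_add, pow_one]
      have h0 : (0 : ℤ) ≤ j₀ := Int.natCast_nonneg j₀
      obtain ⟨hsk, htk⟩ := hch (n - j₀) le_rfl (by linarith)
      exact step (n - j₀) t le_rfl (by linarith) ht hsk htk hbot
    | succ j ih =>
      intro hj
      have hj' : j ≤ j₀ := Nat.le_of_succ_le hj
      have h1 := ih hj'
      set k : ℤ := n - j₀ + j with hk
      have hk1 : n - j₀ ≤ k := by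
        have : (0 : ℤ) ≤ j := Int.natCast_nonneg j
        rw [hk]; linarith
      have hk2 : k + 1 ≤ n := by
        have : (j : ℤ) + 1 ≤ j₀ := by exact_mod_cast hj
        rw [hk]; linarith
      have hpk : p k ∈ Ico 0 Tstar := (hU k).1
      obtain ⟨-, htk⟩ := hch k hk1 (by linarith)
      obtain ⟨hsk1, -⟩ := hch (k + 1) (by linarith) hk2
      have h2 := step (k + 1) (p k) (by linarith) hk2 hpk (hsk1.trans htk) (hO k) (by rw [add_sub_cancel_right])
      have e : n - (j₀ : ℤ) + ((j + 1 : ℕ) : ℤ) = k + 1 := by rw [hk]; push_cast; ring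
      rw [e, pow_succ]
      calc Tstar - t ≤ C ^ (j + 1) * (Tstar - p k) := h1
        _ ≤ C ^ (j + 1) * (C * (Tstar - p (k + 1))) := mul_le_mul_of_nonneg_left h2 (pow_nonneg hC0 _)
        _ = C ^ (j + 1) * C * (Tstar - p (k + 1)) := by ring
  have h := main j₀ le_rfl
  have e : n - (j₀ : ℤ) + (j₀ : ℤ) = n := by ring
  rw [e] at h
  exact h

/-- **(U) + (O) + (L) + (E) + (B) ⟹ (R′), for one bundle.**  With the data of `chain_iterate_fired` available at every
pre-peak time of renormalised level `≥ c₀` (fired chain of length `< J`), every shell obeys the peak delay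
`T* − t ≤ K(T* − pₙ)` whenever `ΛⁿXₙ(t)(T*−t) ≥ c₀`, with `K = (C₁C₂)^J`.
[cite: Tao2016AveragedNS, §1.2 (dyadic model), §4 Lemma 4.1 (4.8); elementary (door D4′ of stmt-21808)] -/
theorem peakDelay_of_firedChain {X : ℤ → ℝ → ℝ} {Λ KI c c₁ c₂ c₀ Tstar δ : ℝ} {p s : ℤ → ℝ} {J : ℕ}
    (hΛ : 0 < Λ) (hc : 0 < c) (hδ : 0 < δ) (hcc : c₁ * c₂ ≤ Λ ^ 2 * c ^ 2 / 2)
    (hlaw : ∀ m : ℤ, ∀ τ ∈ Ioo (-δ) Tstar,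
      HasDerivAt (X m) (Λ ^ (m - 1) * X (m - 1) τ ^ 2 - Λ ^ m * X m τ * X (m + 1) τ) τ)
    (hnn : ∀ m : ℤ, ∀ τ ∈ Ico 0 Tstar, 0 ≤ X m τ)
    (htypeI : ∀ m : ℤ, ∀ τ ∈ Ico 0 Tstar, Λ ^ m * X m τ * (Tstar - τ) ≤ KI)
    (hU : ∀ m : ℤ, p m ∈ Ico 0 Tstar ∧ MonotoneOn (X m) (Icc 0 (p m)) ∧ AntitoneOn (X m) (Ico (p m) Tstar))
    (hO : ∀ m : ℤ, p m ≤ p (m + 1))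
    (hE : ∀ k : ℤ, ∀ τ ∈ Icc (s k) (s (k + 1)), τ ∈ Ico 0 Tstar →
      Λ ^ (k + 1) * X (k + 1) τ * (Tstar - τ) ≤ c₁ ∧ Λ ^ (k + 2) * X (k + 2) τ * (Tstar - τ) ≤ c₂)
    (hL : ∀ k : ℤ, ∀ τ ∈ Icc (s k) (p k), τ ∈ Ico 0 Tstar → c ≤ Λ ^ k * X k τ * (Tstar - τ))
    (hB : ∀ (n : ℤ) (t : ℝ), t ∈ Ico 0 Tstar → c₀ ≤ Λ ^ n * X n t * (Tstar - t) → t < p n →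
      ∃ j₀ : ℕ, j₀ < J ∧ p (n - j₀ - 1) ≤ t ∧ ∀ k : ℤ, n - j₀ ≤ k → k ≤ n → s k ≤ t ∧ t ≤ p k) :
    ∀ (n : ℤ), ∀ t ∈ Ico 0 Tstar, c₀ ≤ Λ ^ n * X n t * (Tstar - t) →
      Tstar - t ≤ ((2 + 4 * Λ * KI ^ 2 / c ^ 3) * (1 + Λ ^ 2 * KI ^ 2 / (c * c))) ^ J * (Tstar - p n) := by
  intro n t ht hlev
  set C : ℝ := (2 + 4 * Λ * KI ^ 2 / c ^ 3) * (1 + Λ ^ 2 * KI ^ 2 / (c * c)) with hC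
  have hC1 : 1 ≤ C := by
    have h1 : 0 ≤ 4 * Λ * KI ^ 2 / c ^ 3 := by positivity
    have h2 : 0 ≤ Λ ^ 2 * KI ^ 2 / (c * c) := by positivity
    rw [hC]; nlinarith
  have hpn : p n < Tstar := (hU n).1.2
  rcases le_or_gt (p n) t with hle | hlt
  · have h1 : Tstar - t ≤ Tstar - p n := by linarith
    have h2 : Tstar - p n ≤ C ^ J * (Tstar - p n) :=
      le_mul_of_one_le_left (by linarith) (one_le_pow₀ hC1)
    exact h1.trans h2
  · obtain ⟨j₀, hj₀, hbot, hch⟩ := hB n t ht hlev hlt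
    have h := chain_iterate_fired hΛ hc hδ hcc hlaw hnn htypeI hU hO hE hL ht hbot hch
    have h2 : C ^ (j₀ + 1) ≤ C ^ J := pow_le_pow_right₀ hC1 (by omega)
    exact h.trans (mul_le_mul_of_nonneg_right h2 (by linarith))

/-- **(U) + (O) + (L) + (E) + (B) at arbitrarily small scale ratios ⟹ (D).**
[cite: Tao2016AveragedNS, §1.2 (dyadic model), §4 Lemma 4.1 (4.8), §6.4; cell vocabulary (door D4′ of stmt-21808)] -/
theorem cauchyPostFiringBound_of_firedChain
    (H : ∀ ε : ℝ, 0 < ε → ∃ ε₀ : ℝ, 0 < ε₀ ∧ ε₀ ≤ ε ∧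
      ∀ (Tstar : ℝ) (X : ℤ → ℝ → ℝ), 0 < Tstar →
        (∀ n : ℤ, X n 0 = if n = 0 then 1 else 0) →
        (∀ n : ℤ, ∀ t ∈ Ioo (-(1 / ((bigLam ε₀ + (bigLam ε₀)⁻¹) * (1 + 1) ^ 2 + 1))) Tstar,
          HasDerivAt (X n) (bigLam ε₀ ^ (n - 1) * X (n - 1) t ^ 2 - bigLam ε₀ ^ n * X n t * X (n + 1) t) t) →
        (∀ T', T' < Tstar → ∃ B : ℝ, ∀ n : ℤ,
          ∀ t ∈ Ioo (-(1 / ((bigLam ε₀ + (bigLam ε₀)⁻¹) * (1 + 1) ^ 2 + 1))) T', |bigLam ε₀ ^ n * X n t| ≤ B) →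
        (∀ n : ℤ, ∀ t ∈ Ico 0 Tstar, 0 ≤ X n t) →
        (∀ n : ℤ, ∀ t ∈ Ico 0 Tstar,
          bigLam ε₀ ^ n * X n t * (Tstar - t) ≤ 2 * bigLam ε₀ ^ 2 / (bigLam ε₀ - 1) ^ 2) →
        (∀ t ∈ Ioo (-(1 / ((bigLam ε₀ + (bigLam ε₀)⁻¹) * (1 + 1) ^ 2 + 1))) Tstar, ∀ β : ℝ, 0 < β →
          (∀ n : ℤ, |bigLam ε₀ ^ n * X n t| ≤ β) → 1 ≤ (bigLam ε₀ + (bigLam ε₀)⁻¹) * β * (Tstar - t)) →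
        ∃ (p s : ℤ → ℝ) (c c₁ c₂ : ℝ) (J : ℕ), 0 < c ∧ c₁ * c₂ ≤ bigLam ε₀ ^ 2 * c ^ 2 / 2 ∧
          (∀ m : ℤ, p m ∈ Ico 0 Tstar ∧ MonotoneOn (X m) (Icc 0 (p m)) ∧ AntitoneOn (X m) (Ico (p m) Tstar)) ∧
          (∀ m : ℤ, p m ≤ p (m + 1)) ∧
          (∀ k : ℤ, ∀ τ ∈ Icc (s k) (s (k + 1)), τ ∈ Ico 0 Tstar →
            bigLam ε₀ ^ (k + 1) * X (k + 1) τ * (Tstar - τ) ≤ c₁ ∧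
            bigLam ε₀ ^ (k + 2) * X (k + 2) τ * (Tstar - τ) ≤ c₂) ∧
          (∀ k : ℤ, ∀ τ ∈ Icc (s k) (p k), τ ∈ Ico 0 Tstar → c ≤ bigLam ε₀ ^ k * X k τ * (Tstar - τ)) ∧
          (∀ (n : ℤ) (t : ℝ), t ∈ Ico 0 Tstar →
            1 / (2 * (bigLam ε₀ + (bigLam ε₀)⁻¹)) ≤ bigLam ε₀ ^ n * X n t * (Tstar - t) → t < p n →
            ∃ j₀ : ℕ, j₀ < J ∧ p (n - j₀ - 1) ≤ t ∧ ∀ k : ℤ, n - j₀ ≤ k → k ≤ n → s k ≤ t ∧ t ≤ p k)) :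
    DyadicCauchyPostFiringBound := by
  refine cauchyPostFiringBound_of_unimodal fun ε hε => ?_
  obtain ⟨ε₀, hε₀, hle, H'⟩ := H ε hε
  refine ⟨ε₀, hε₀, hle, ?_⟩
  intro Tstar X hT h0 hlaw hreg hnn htypeI hlow
  obtain ⟨p, s, c, c₁, c₂, J, hc, hcc, hU, hO, hE, hL, hB⟩ := H' Tstar X hT h0 hlaw hreg hnn htypeI hlow
  have hΛ : 0 < bigLam ε₀ := bigLam_pos (by linarith)
  have hδ : 0 < 1 / ((bigLam ε₀ + (bigLam ε₀)⁻¹) * (1 + 1) ^ 2 + 1) := by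
    have : 0 < (bigLam ε₀)⁻¹ := inv_pos.2 hΛ
    positivity
  have hR := peakDelay_of_firedChain hΛ hc hδ hcc hlaw hnn htypeI hU hO hE hL hB
  exact ⟨((2 + 4 * bigLam ε₀ * (2 * bigLam ε₀ ^ 2 / (bigLam ε₀ - 1) ^ 2) ^ 2 / c ^ 3) *
      (1 + bigLam ε₀ ^ 2 * (2 * bigLam ε₀ ^ 2 / (bigLam ε₀ - 1) ^ 2) ^ 2 / (c * c))) ^ J,
    fun n => ⟨p n, (hU n).1, (hU n).2.1, (hU n).2.2, fun t ht hlev => hR n t ht hlev⟩⟩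

/-- **(U) + (O) + (L) + (E) + (B) at arbitrarily small scale ratios ⟹ ¬ TailRatchet** (composition with the tree's
`TailRatchet_false_of_DyadicCauchyPostFiringBound`).  Conditional refutation; nothing is settled.
[cite: Tao2016AveragedNS, §1.2 (dyadic model), §4 Lemma 4.1 (4.8), §6.4; cell vocabulary (door D4′ of stmt-21808)] -/
theorem TailRatchet_false_of_firedChain
    (H : ∀ ε : ℝ, 0 < ε → ∃ ε₀ : ℝ, 0 < ε₀ ∧ ε₀ ≤ ε ∧
      ∀ (Tstar : ℝ) (X : ℤ → ℝ → ℝ), 0 < Tstar →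
        (∀ n : ℤ, X n 0 = if n = 0 then 1 else 0) →
        (∀ n : ℤ, ∀ t ∈ Ioo (-(1 / ((bigLam ε₀ + (bigLam ε₀)⁻¹) * (1 + 1) ^ 2 + 1))) Tstar,
          HasDerivAt (X n) (bigLam ε₀ ^ (n - 1) * X (n - 1) t ^ 2 - bigLam ε₀ ^ n * X n t * X (n + 1) t) t) →
        (∀ T', T' < Tstar → ∃ B : ℝ, ∀ n : ℤ,
          ∀ t ∈ Ioo (-(1 / ((bigLam ε₀ + (bigLam ε₀)⁻¹) * (1 + 1) ^ 2 + 1))) T', |bigLam ε₀ ^ n * X n t| ≤ B) →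
        (∀ n : ℤ, ∀ t ∈ Ico 0 Tstar, 0 ≤ X n t) →
        (∀ n : ℤ, ∀ t ∈ Ico 0 Tstar,
          bigLam ε₀ ^ n * X n t * (Tstar - t) ≤ 2 * bigLam ε₀ ^ 2 / (bigLam ε₀ - 1) ^ 2) →
        (∀ t ∈ Ioo (-(1 / ((bigLam ε₀ + (bigLam ε₀)⁻¹) * (1 + 1) ^ 2 + 1))) Tstar, ∀ β : ℝ, 0 < β →
          (∀ n : ℤ, |bigLam ε₀ ^ n * X n t| ≤ β) → 1 ≤ (bigLam ε₀ + (bigLam ε₀)⁻¹) * β * (Tstar - t)) →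
        ∃ (p s : ℤ → ℝ) (c c₁ c₂ : ℝ) (J : ℕ), 0 < c ∧ c₁ * c₂ ≤ bigLam ε₀ ^ 2 * c ^ 2 / 2 ∧
          (∀ m : ℤ, p m ∈ Ico 0 Tstar ∧ MonotoneOn (X m) (Icc 0 (p m)) ∧ AntitoneOn (X m) (Ico (p m) Tstar)) ∧
          (∀ m : ℤ, p m ≤ p (m + 1)) ∧
          (∀ k : ℤ, ∀ τ ∈ Icc (s k) (s (k + 1)), τ ∈ Ico 0 Tstar →
            bigLam ε₀ ^ (k + 1) * X (k + 1) τ * (Tstar - τ) ≤ c₁ ∧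
            bigLam ε₀ ^ (k + 2) * X (k + 2) τ * (Tstar - τ) ≤ c₂) ∧
          (∀ k : ℤ, ∀ τ ∈ Icc (s k) (p k), τ ∈ Ico 0 Tstar → c ≤ bigLam ε₀ ^ k * X k τ * (Tstar - τ)) ∧
          (∀ (n : ℤ) (t : ℝ), t ∈ Ico 0 Tstar →
            1 / (2 * (bigLam ε₀ + (bigLam ε₀)⁻¹)) ≤ bigLam ε₀ ^ n * X n t * (Tstar - t) → t < p n →
            ∃ j₀ : ℕ, j₀ < J ∧ p (n - j₀ - 1) ≤ t ∧ ∀ k : ℤ, n - j₀ ≤ k → k ≤ n → s k ≤ t ∧ t ≤ p k)) :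
    ¬ Summit.NavierStokesRegularity.NavierStokesRegularity.Theses.WakeRatchet.TailRatchet :=
  TailRatchet_false_of_DyadicCauchyPostFiringBound (cauchyPostFiringBound_of_firedChain H)

end WakeRatchetPeakDelaySelfDrain

end Summit.NavierStokesRegularity.NavierStokesRegularity.Theorems

end
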